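import Literature.MathematicalPhysics.KineticTheory.HardSphereEulerSmoothFamiliesOfSymmHyperbolic
import Literature.Analysis.PDE.SymmHyperbolicLocalExistenceDimAll
import HarnessLib

/-!
# Smooth families of classical hard-sphere Euler solutions at small packing — PROVED
# (topic `MathematicalPhysics/KineticTheory`)

KineticTheory proof file (one theorem; no definitions, no named facts): the named fact
`hsEuler_smoothFamilyWellposedness` (`HardSphereEulerSmoothFamilies.lean`: smooth one-parameter
families of classical solutions of the hard-sphere (Enskog) Euler system at small packing, common
life span, joint smoothness — Kato 1975 Thms II–III via Dafermos 2005 Thm 5.1.1) holds in the tree: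
the PROVED reduction `hsEuler_smoothFamilyWellposedness_of_symmHyperbolic`
(`HardSphereEulerSmoothFamiliesOfSymmHyperbolic`) applied to the PROVED generic fact
`Literature.Analysis.PDE.symmHyperbolic_smoothFamilies_holds` (`SymmHyperbolicLocalExistenceDimAll`:
Majda's theorem on `𝕋ᵈ` for every `d` + parameter as a fourth space variable).

## References

* C. M. Dafermos, *Hyperbolic Conservation Laws in Continuum Physics*, 2nd ed., Springer 2005,
  §5.1, Thm 5.1.1. [`Dafermos2005`]
* T. Kato, Arch. Rational Mech. Anal. 58 (1975) 181–205, Thms II–III. [`Kato1975`]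
-/

noncomputable section

namespace Literature.MathematicalPhysics.KineticTheory

/-- **Smooth one-parameter families of classical hard-sphere Euler solutions at small packing
(PROVED)** — the named fact `hsEuler_smoothFamilyWellposedness` (`HardSphereEulerSmoothFamilies`;
the `[WD]` piece of the PreShockDoor node of `Summit.AtomisticToContinuum.HydrodynamicLimit`)
holds: Dafermos's reduction to symmetric hyperbolic form
(`hsEuler_smoothFamilyWellposedness_of_symmHyperbolic`) applied to the PROVED generic fact
`Literature.Analysis.PDE.symmHyperbolic_smoothFamilies_holds`.
[cite: Dafermos2005, Thm 5.1.1] [cite: Kato1975, Thms II–III] -/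
theorem hsEuler_smoothFamilyWellposedness_holds : hsEuler_smoothFamilyWellposedness :=
  hsEuler_smoothFamilyWellposedness_of_symmHyperbolic
    Literature.Analysis.PDE.symmHyperbolic_smoothFamilies_holds

end Literature.MathematicalPhysics.KineticTheory

end
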